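import Literature.Barriers.CriticalPhenomena.WeaklySAWPerturbativeBeta
import Literature.Barriers.CriticalPhenomena.FiniteRangeDecompositionMassless
import HarnessLib

/-!
# BBS 2015, §6.1: `β_j` depends continuously on `m² ∈ [0,∞)` — including the critical value
# `m² = 0` —, `β_j(m²) ≥ 0`, and `(β_j)` is bounded (Assumption (A1)) for `d = 4`

Continuation of `WeaklySAWPerturbativeBeta.lean` (the sequence
`β_j = 8Σ_x(w_{j+1,x}² - w_{j,x}²)`, `w_j = Σ_{i=1}^jC_i`, of Bauerschmidt–Brydges–Slade, CMP 337
(2015), arXiv:1403.7422, §6.1, for the explicit finite-range decomposition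
`C_i = LongRangePhi4.FRD.Gam d L m² i`, and Lemma 8.3.1 `Σ_jβ_j = 𝖡_{m²}` for `m² > 0`) and of
`FiniteRangeDecompositionMassless.lean` (continuity of `C_i(x;m²)` in `m² ∈ [0,∞)` including
`m² = 0`, the limits `m² ↓ 0`, and the scaling estimate uniformly in `m² ≥ 0`).

§6.1 of the source: "The `m²`-dependence of `β_j` is suppressed in the notation. Since each `C_i` is
positive-definite, the above definition implies that `β_j > 0` for all `j`. … These coefficients
[`β_j, θ_j, η_j, ξ_j, π_j`] … depend continuously on the mass `m²` appearing in the covariance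
decomposition … **Assumption (A1).** The sequence `(β_j)` is bounded, namely
`β_∞ = sup_{j∈ℕ₀}|β_j| < ∞`. There exists `c > 0` such that `β_j ≥ c` for all but `c⁻¹` values
of `j ≤ j_Ω`. … In [BBS-rg-pt], it is verified that … they depend continuously on `m²`. In particular,
it is shown that the following two assumptions [(A1)–(A2)] are satisfied." Also §5.1: "In our analysis,
the value `m² = 0` corresponds to `ν = ν_c`" — so `β_j` at `m² = 0` is the critical sequence.

## What this file proves (everything; no definition, no named fact)

* `continuousWithinAt_covSum_mass`, `betaPT_eq_sum`, **`continuousWithinAt_betaPT_mass`** —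
  **`m² ↦ β_j(m²)` is continuous on `[0,∞)`, including at `m² = 0`** (`d ≥ 1`, `L ≥ 1`), and
  **`tendsto_betaPT_mass`** — `β_j(m²) → β_j(0)` as `m² ↓ 0`, the critical coefficient being
  `betaPT d L 0 j` itself ("depend continuously on the mass `m²`");
* **`betaPT_nonneg_of_nonneg`** — `β_j(m²) ≥ 0` for all `m² ≥ 0` (`L > 1`; at `m² = 0` as the limit of
  the case `m² > 0` of the previous file);
* `abs_Gam_four_le`, `abs_covSum_four_le` (the pointwise bounds `|C_{i+1;0x}| ≤ cL^{-2i}𝟙{|x|₁<½L^{i+1}}`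
  at `d = 4` from the scaling estimate), `sum_ball_indicator_le`, `geom_sum_sq_le`, and
  **`BBS2015_A1_bounded`** — **the first clause of Assumption (A1) for the weakly self-avoiding
  walk in `d = 4`, PROVED for the explicit decomposition**: there is `K` with
  `|β_j(m²)| ≤ KL⁴` for all `L ≥ 2`, `m² ≥ 0` and `j` (so `β_∞ = sup_j|β_j| < ∞`; the constant is
  `L`-dependent, as all constants of the source may be).

Not treated here: the second clause of (A1) (`β_j ≥ c` for most `j ≤ j_Ω`, i.e. the existence of the
positive limit `lim_jβ_j(0)`, [BBS-rg-pt]) and (A2).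
-/

noncomputable section

open MeasureTheory Set Filter Topology
open Literature.Probability.LatticeModels
open scoped BigOperators Real

namespace Literature.Barriers.CriticalPhenomena

namespace CTWSAW

open LongRangePhi4 LongRangePhi4.FRD

variable {d : ℕ}

/-! ### Continuity of `w_j` and `β_j` in the mass `m² ∈ [0,∞)` -/

/-- `m² ↦ w_j(x;m²)` is continuous on `[0,∞)` at every `m² ≥ 0` (`d ≥ 1`, `L ≥ 0`).
[cite: BauerschmidtBrydgesSlade2015LogCorr, §6.1 ("depend continuously on the mass m² appearing in the covariance decomposition")] -/
theorem continuousWithinAt_covSum_mass (hd : 1 ≤ d) {L : ℝ} (hL : 0 ≤ L) (j : ℕ) (x : Site d)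
    {s₀ : ℝ} (hs₀ : 0 ≤ s₀) : ContinuousWithinAt (fun s => covSum d L s j x) (Ici 0) s₀ := by
  unfold covSum
  exact tendsto_finsetSum (Finset.range j) fun i _ =>
    (continuousWithinAt_Gam_mass hd hL (i + 1) x hs₀).tendsto

/-- `β_j(m²) = 8Σ_{|x|₁<½L^{j+1}}(w_{j+1,x}² - w_{j,x}²)` for every `m² ≥ 0` (finite range).
[cite: BauerschmidtBrydgesSlade2015LogCorr, §6.1 (definition of β_j) and §5.1 (finite range)] -/
theorem betaPT_eq_sum (hd : 1 ≤ d) {L : ℝ} (hL : 1 ≤ L) {m2 : ℝ} (hm : 0 ≤ m2) (j : ℕ) :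
    betaPT d L m2 j = 8 * ∑ x ∈ PT.ball (L ^ (j + 1) / 2),
      (covSum d L m2 (j + 1) x ^ 2 - covSum d L m2 j x ^ 2) := by
  unfold betaPT
  rw [tsum_sq_sub_sq_eq_sum hd hL hm j le_rfl]

/-- **`m² ↦ β_j(m²)` is continuous on `[0,∞)`, including at the critical value `m² = 0`**
(`d ≥ 1`, `L ≥ 1`). [cite: BauerschmidtBrydgesSlade2015LogCorr, §6.1 ("These coefficients … depend continuously on the mass m²")] -/
theorem continuousWithinAt_betaPT_mass (hd : 1 ≤ d) {L : ℝ} (hL : 1 ≤ L) (j : ℕ) {s₀ : ℝ}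
    (hs₀ : 0 ≤ s₀) : ContinuousWithinAt (fun s => betaPT d L s j) (Ici 0) s₀ := by
  have hL0 : 0 ≤ L := zero_le_one.trans hL
  have hf : ContinuousWithinAt (fun s => 8 * ∑ x ∈ PT.ball (L ^ (j + 1) / 2),
      (covSum d L s (j + 1) x ^ 2 - covSum d L s j x ^ 2)) (Ici 0) s₀ := by
    refine ContinuousWithinAt.mul continuousWithinAt_const ?_
    exact tendsto_finsetSum _ fun x _ =>
      (((continuousWithinAt_covSum_mass hd hL0 (j + 1) x hs₀).pow 2).sub
        ((continuousWithinAt_covSum_mass hd hL0 j x hs₀).pow 2)).tendsto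
  exact hf.congr (fun s hs => betaPT_eq_sum hd hL hs j) (betaPT_eq_sum hd hL hs₀ j)

/-- **`β_j(m²) → β_j(0)` as `m² ↓ 0`**: the critical coefficient (`m² = 0`, i.e. `ν = ν_c`) is the limit
of the massive ones and is `betaPT d L 0 j`. [cite: BauerschmidtBrydgesSlade2015LogCorr, §6.1 ("depend continuously on the mass m²") and §5.1 ("the value m² = 0 corresponds to ν = ν_c")] -/
theorem tendsto_betaPT_mass (hd : 1 ≤ d) {L : ℝ} (hL : 1 ≤ L) (j : ℕ) :
    Tendsto (fun s => betaPT d L s j) (𝓝[>] 0) (𝓝 (betaPT d L 0 j)) :=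
  ((continuousWithinAt_betaPT_mass hd hL j le_rfl).tendsto).mono_left
    (nhdsWithin_mono _ Ioi_subset_Ici_self)

/-- **`β_j(m²) ≥ 0` for all `m² ≥ 0`** (`d ≥ 1`, `L > 1`; at `m² = 0` as the limit of `β_j(m²) ≥ 0`,
`m² > 0`). [cite: BauerschmidtBrydgesSlade2015LogCorr, §6.1 ("the above definition implies that β_j > 0 for all j")] -/
theorem betaPT_nonneg_of_nonneg (hd : 1 ≤ d) {L : ℝ} (hL : 1 < L) {m2 : ℝ} (hm : 0 ≤ m2) (j : ℕ) :
    0 ≤ betaPT d L m2 j := by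
  rcases hm.lt_or_eq with h | h
  · exact betaPT_nonneg hd hL h j
  · rw [← h]
    exact ge_of_tendsto (tendsto_betaPT_mass hd hL.le j)
      (eventually_mem_nhdsWithin.mono fun s hs => betaPT_nonneg hd hL hs j)

/-! ### Assumption (A1), first clause: `(β_j)` is bounded (`d = 4`) -/

/-- The scaling estimate at `d = 4`: **`|C_{i+1;0x}(m²)| ≤ c/L^{2i}`** for all `L ≥ 2`, `m² ≥ 0`, `i`, `x`.
[cite: BauerschmidtBrydgesSlade2015LogCorr, §5.2 (the scaling estimate, α = β = 0, d = 4: |C_{j;x,y}| ≤ cL^{-2(j-1)})] -/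
theorem abs_Gam_four_le : ∃ c : ℝ, 0 < c ∧ ∀ L : ℝ, 2 ≤ L → ∀ s : ℝ, 0 ≤ s → ∀ i : ℕ,
    ∀ x : Site 4, |Gam 4 L s (i + 1) x| ≤ c / L ^ (2 * i) := by
  obtain ⟨c, hc, h⟩ := abs_Gam_le_of_nonneg (d := 4) (by norm_num)
  refine ⟨c, hc, fun L hL s hs i x => ?_⟩
  have hL0 : L ≠ 0 := by linarith
  have := h L hL s hs (i + 1) (by omega) x
  rw [Nat.add_sub_cancel, scale_ratio_eq hL0 (by norm_num) i] at this
  refine this.trans (le_of_eq ?_)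
  rw [show (4 - 2 : ℕ) = 2 by norm_num, one_div, inv_pow, ← pow_mul, div_eq_mul_inv]

/-- **`|w_j(x;m²)| ≤ Σ_{i<j}(c/L^{2i})𝟙{|x|₁ < ½L^{i+1}}`** at `d = 4` (finite range and the scaling
estimate of each term). [cite: BauerschmidtBrydgesSlade2015LogCorr, §5.1–§5.2 (finite range and scaling estimates of C_j)] -/
theorem abs_covSum_four_le {c : ℝ}
    (hc : ∀ L : ℝ, 2 ≤ L → ∀ s : ℝ, 0 ≤ s → ∀ i : ℕ, ∀ x : Site 4, |Gam 4 L s (i + 1) x| ≤ c / L ^ (2 * i))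
    {L : ℝ} (hL : 2 ≤ L) {s : ℝ} (hs : 0 ≤ s) (j : ℕ) (x : Site 4) :
    |covSum 4 L s j x| ≤ ∑ i ∈ Finset.range j,
      c / L ^ (2 * i) * (if x ∈ PT.ball (L ^ (i + 1) / 2) then (1 : ℝ) else 0) := by
  unfold covSum
  refine (Finset.abs_sum_le_sum_abs _ _).trans (Finset.sum_le_sum fun i _ => ?_)
  split_ifs with hx
  · rw [mul_one]; exact hc L hL s hs i x
  · rw [mul_zero]
    rw [PT.mem_ball, not_lt] at hx
    rw [Gam_eq_zero (by norm_num) (by linarith) hs (i + 1) x hx, abs_zero]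

/-- Counting in `ℤ⁴`: `#{|x|₁ < ½L^{i+1}} ≤ (L^{i+1}+1)⁴ ≤ 16L⁴L^{4i}` (`L ≥ 1`). [folklore] -/
theorem card_ball_four_le {L : ℝ} (hL : 1 ≤ L) (i : ℕ) :
    ((PT.ball (d := 4) (L ^ (i + 1) / 2)).card : ℝ) ≤ 16 * L ^ 4 * L ^ (4 * i) := by
  have hR : 0 ≤ L ^ (i + 1) / 2 := by positivity
  have h2 := PT.card_ball_le (d := 4) hR
  have hLi : 1 ≤ L ^ (i + 1) := one_le_pow₀ hL
  have h3 : (2 * (L ^ (i + 1) / 2) + 1) ^ 4 ≤ 16 * L ^ 4 * L ^ (4 * i) := by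
    have e : 2 * (L ^ (i + 1) / 2) + 1 = L ^ (i + 1) + 1 := by ring
    rw [e]
    calc (L ^ (i + 1) + 1) ^ 4 ≤ (2 * L ^ (i + 1)) ^ 4 :=
          pow_le_pow_left₀ (by positivity) (by linarith) 4
      _ = 16 * L ^ 4 * L ^ (4 * i) := by ring
  exact h2.trans h3

/-- `Σ_{x∈S}𝟙{|x|₁ < ½L^{i+1}} ≤ 16L⁴L^{4i}` for any finite `S ⊂ ℤ⁴`. [folklore] -/
theorem sum_ball_indicator_le (S : Finset (Site 4)) {L : ℝ} (hL : 1 ≤ L) (i : ℕ) :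
    ∑ x ∈ S, (if x ∈ PT.ball (L ^ (i + 1) / 2) then (1 : ℝ) else 0) ≤ 16 * L ^ 4 * L ^ (4 * i) := by
  classical
  rw [Finset.sum_boole]
  have h1 : ((S.filter fun x => x ∈ PT.ball (L ^ (i + 1) / 2)).card : ℝ) ≤
      (PT.ball (d := 4) (L ^ (i + 1) / 2)).card := by
    exact_mod_cast Finset.card_le_card fun x hx => (Finset.mem_filter.1 hx).2
  exact h1.trans (card_ball_four_le hL i)

/-- `Σ_{i<j}L^{2i} ≤ 2L^{2j}` for `L ≥ 2`. [folklore] -/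
theorem geom_sum_sq_le {L : ℝ} (hL : 2 ≤ L) (j : ℕ) :
    ∑ i ∈ Finset.range j, L ^ (2 * i) ≤ 2 * L ^ (2 * j) := by
  induction j with
  | zero => simp
  | succ j ih =>
    rw [Finset.sum_range_succ]
    have h1 : L ^ (2 * (j + 1)) = L ^ 2 * L ^ (2 * j) := by ring
    have h2 : 0 ≤ L ^ (2 * j) := by positivity
    have h4 : (4 : ℝ) ≤ L ^ 2 := by nlinarith
    rw [h1]
    nlinarith

/-- **BBS 2015, Assumption (A1), first clause, for the weakly self-avoiding walk in `d = 4`, PROVED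
for the explicit decomposition**: "The sequence `(β_j)` is bounded, namely `β_∞ = sup_j|β_j| < ∞`" —
here quantitatively and uniformly in the mass: there is `K` with `|β_j(m²)| ≤ KL⁴` for all `L ≥ 2`,
`m² ≥ 0` and all `j` (from `w_{j+1}² - w_j² = C_{j+1}(2w_j + C_{j+1})`, the scaling estimate
`|C_{i;0x}| ≤ cL^{-2(i-1)}`, finite range and counting; `d = 4` is exactly the dimension in which
this bound is uniform in `j`). [cite: BauerschmidtBrydgesSlade2015LogCorr, §6.1, Assumption (A1) ("The sequence (β_j) is bounded")] -/
theorem BBS2015_A1_bounded : ∃ K : ℝ, 0 < K ∧ ∀ L : ℝ, 2 ≤ L → ∀ s : ℝ, 0 ≤ s → ∀ j : ℕ,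
    |betaPT 4 L s j| ≤ K * L ^ 4 := by
  obtain ⟨c, hc, h⟩ := abs_Gam_four_le
  refine ⟨640 * c ^ 2, by positivity, fun L hL s hs j => ?_⟩
  classical
  have hL1 : (1 : ℝ) ≤ L := by linarith
  have hL0 : (0 : ℝ) < L := by linarith
  have hL4 : 0 ≤ L ^ 4 := by positivity
  -- abbreviations: `a_i = c/L^{2i}`, the indicators, `S = {|x|₁ < ½L^{j+1}}`
  set a : ℕ → ℝ := fun i => c / L ^ (2 * i) with ha
  set ind : ℕ → Site 4 → ℝ := fun i x => if x ∈ PT.ball (L ^ (i + 1) / 2) then (1 : ℝ) else 0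
    with hind
  have ha0 : ∀ i, 0 ≤ a i := fun i => by simp only [ha]; positivity
  have hind0 : ∀ i x, 0 ≤ ind i x := fun i x => by
    simp only [hind]; split_ifs <;> norm_num
  have hai : ∀ i, a i * (16 * L ^ 4 * L ^ (4 * i)) = 16 * c * L ^ 4 * L ^ (2 * i) := by
    intro i
    simp only [ha]
    have : L ^ (4 * i) = L ^ (2 * i) * L ^ (2 * i) := by rw [← pow_add]; ring_nf
    rw [this]
    field_simp
  have haj : a j * L ^ (2 * j) = c := by
    simp only [ha]; field_simp
  -- pointwise bound on the summand: `|w_{j+1}² - w_j²| = |C_{j+1}||2w_j + C_{j+1}|`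
  have hpt : ∀ x : Site 4, |covSum 4 L s (j + 1) x ^ 2 - covSum 4 L s j x ^ 2| ≤
      a j * (2 * ∑ i ∈ Finset.range j, a i * ind i x + a j) := by
    intro x
    have hG : |Gam 4 L s (j + 1) x| ≤ a j := h L hL s hs j x
    have hw : |covSum 4 L s j x| ≤ ∑ i ∈ Finset.range j, a i * ind i x :=
      abs_covSum_four_le h hL hs j x
    rw [covSum_succ]
    have e : (covSum 4 L s j x + Gam 4 L s (j + 1) x) ^ 2 - covSum 4 L s j x ^ 2 =
        Gam 4 L s (j + 1) x * (2 * covSum 4 L s j x + Gam 4 L s (j + 1) x) := by ring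
    rw [e, abs_mul]
    refine mul_le_mul hG ?_ (abs_nonneg _) (ha0 j)
    calc |2 * covSum 4 L s j x + Gam 4 L s (j + 1) x|
        ≤ |2 * covSum 4 L s j x| + |Gam 4 L s (j + 1) x| := abs_add_le _ _
      _ ≤ 2 * ∑ i ∈ Finset.range j, a i * ind i x + a j := by
          rw [abs_mul, abs_two]; exact add_le_add (by linarith) hG
  -- summing over `S`
  have hS1 : ∑ x ∈ PT.ball (L ^ (j + 1) / 2),
      |covSum 4 L s (j + 1) x ^ 2 - covSum 4 L s j x ^ 2| ≤
      a j * (2 * ∑ x ∈ PT.ball (L ^ (j + 1) / 2), ∑ i ∈ Finset.range j, a i * ind i x +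
        ((PT.ball (d := 4) (L ^ (j + 1) / 2)).card : ℝ) * a j) := by
    refine (Finset.sum_le_sum fun x _ => hpt x).trans (le_of_eq ?_)
    rw [← Finset.mul_sum, Finset.sum_add_distrib, Finset.sum_const, nsmul_eq_mul, ← Finset.mul_sum]
  have hS2 : ∑ x ∈ PT.ball (L ^ (j + 1) / 2), ∑ i ∈ Finset.range j, a i * ind i x =
      ∑ i ∈ Finset.range j, a i * ∑ x ∈ PT.ball (L ^ (j + 1) / 2), ind i x := by
    rw [Finset.sum_comm]
    exact Finset.sum_congr rfl fun i _ => by rw [Finset.mul_sum]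
  have hI : ∀ i, ∑ x ∈ PT.ball (L ^ (j + 1) / 2), ind i x ≤ 16 * L ^ 4 * L ^ (4 * i) :=
    fun i => sum_ball_indicator_le _ hL1 i
  have hcard : ((PT.ball (d := 4) (L ^ (j + 1) / 2)).card : ℝ) ≤ 16 * L ^ 4 * L ^ (4 * j) :=
    card_ball_four_le hL1 j
  have hS3 : ∑ i ∈ Finset.range j, a i * ∑ x ∈ PT.ball (L ^ (j + 1) / 2), ind i x ≤
      16 * c * L ^ 4 * ∑ i ∈ Finset.range j, L ^ (2 * i) := by
    rw [Finset.mul_sum]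
    refine Finset.sum_le_sum fun i _ => ?_
    rw [← hai i]
    exact mul_le_mul_of_nonneg_left (hI i) (ha0 i)
  have hS4 : ((PT.ball (d := 4) (L ^ (j + 1) / 2)).card : ℝ) * a j ≤ 16 * c * L ^ 4 * L ^ (2 * j) := by
    rw [← hai j, mul_comm]
    exact mul_le_mul_of_nonneg_left hcard (ha0 j)
  have hgeom := geom_sum_sq_le hL j
  -- assemble: `Σ_x |…| ≤ a_j(2·16cL⁴·2L^{2j} + 16cL⁴L^{2j}) = 80cL⁴(a_jL^{2j}) = 80c²L⁴`
  have htot : ∑ x ∈ PT.ball (L ^ (j + 1) / 2),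
      |covSum 4 L s (j + 1) x ^ 2 - covSum 4 L s j x ^ 2| ≤ 80 * c ^ 2 * L ^ 4 := by
    refine hS1.trans ?_
    rw [hS2]
    have k0 : 0 ≤ 16 * c * L ^ 4 := by positivity
    have h1 : 2 * ∑ i ∈ Finset.range j, a i * ∑ x ∈ PT.ball (L ^ (j + 1) / 2), ind i x +
        ((PT.ball (d := 4) (L ^ (j + 1) / 2)).card : ℝ) * a j ≤
        2 * (16 * c * L ^ 4 * (2 * L ^ (2 * j))) + 16 * c * L ^ 4 * L ^ (2 * j) := by
      have := mul_le_mul_of_nonneg_left hgeom k0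
      linarith
    calc a j * (2 * ∑ i ∈ Finset.range j, a i * ∑ x ∈ PT.ball (L ^ (j + 1) / 2), ind i x +
          ((PT.ball (d := 4) (L ^ (j + 1) / 2)).card : ℝ) * a j)
        ≤ a j * (2 * (16 * c * L ^ 4 * (2 * L ^ (2 * j))) + 16 * c * L ^ 4 * L ^ (2 * j)) :=
          mul_le_mul_of_nonneg_left h1 (ha0 j)
      _ = 80 * c * L ^ 4 * (a j * L ^ (2 * j)) := by ring
      _ = 80 * c ^ 2 * L ^ 4 := by rw [haj]; ring
  -- conclude
  rw [betaPT_eq_sum (by norm_num) hL1 hs j, abs_mul, show |(8 : ℝ)| = 8 by norm_num]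
  calc 8 * |∑ x ∈ PT.ball (L ^ (j + 1) / 2), (covSum 4 L s (j + 1) x ^ 2 - covSum 4 L s j x ^ 2)|
      ≤ 8 * (80 * c ^ 2 * L ^ 4) :=
        mul_le_mul_of_nonneg_left ((Finset.abs_sum_le_sum_abs _ _).trans htot) (by norm_num)
    _ = 640 * c ^ 2 * L ^ 4 := by ring

end CTWSAW

end Literature.Barriers.CriticalPhenomena
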